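import Summits.ValiantsHypothesis.ValiantsHypothesis.Theorems.BarrierLeverTransversalMinorLayoutsSevenFaces
import Summits.ValiantsHypothesis.ValiantsHypothesis.Theorems.BarrierLeverTransversalMinorLayoutsClaws

/-!
# Route BarrierLever — conjecture TT (`TransversalMinorLayoutsNonsingular`, stmt-ValiantsHypothesis-19152),
# item `TransversalLayoutsRankLeEight` (stmt-ValiantsHypothesis-19933): eight-face complexes, part A

Helper file (`--supports stmt-ValiantsHypothesis-19933`; cell valiant-natproofs, rung V4, 𝒟-side of
door (c); seat val-np-p1 gen 8).  With eight faces a complex may contain a `2`-simplex: the lower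
family is then the full power set of a `3`-set (the SOLID TRIANGLE).  This part records

* `eq_powerset_of_three_le_card` / `card_le_two_of_five_small`: a lower family of at most `8` sets
  containing a set with `≥ 3` elements is the power set of a `3`-set; hence a lower family of at
  most `8` sets with at least five members of size `≤ 1` consists of sets of size `≤ 2`;
* `exists_pair_of_no_degree_one'`: the graph case of `exists_pair_of_no_degree_one` with the size
  bound as a hypothesis;
* (companion `…EightFacesSolid`: a lower family of exactly eight sets in which no element has
  degree one or two is a SOLID TRIANGLE.)

WHAT THIS IS NOT: bookkeeping for bounded-rank slices of TT; nothing on TT / item 19761 in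
general, on crux stmt-ValiantsHypothesis-14610, or on `VP` versus `VNP`.
-/

-- layout Summits/ValiantsHypothesis/ValiantsHypothesis forces the duplicated namespace component
set_option linter.dupNamespace false

open Matrix Finset

namespace Summit.ValiantsHypothesis.ValiantsHypothesis.Theorems.BarrierLever.FiniteCheck

open Summit.ValiantsHypothesis.ValiantsHypothesis.Theorems.BarrierLever.Compression

/-! ## 1. The solid triangle -/

/-- A lower family of at most eight sets with a member of size `≥ 3` is the power set of a
three-element set. -/
theorem eq_powerset_of_three_le_card {h : ℕ} (F : Finset (Finset (Fin h)))
    (hlow : ∀ x ∈ F, ∀ t, t ⊆ x → t ∈ F) (hF : F.card ≤ 8) (x : Finset (Fin h)) (hx : x ∈ F)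
    (hx3 : 3 ≤ x.card) :
    ∃ S : Finset (Fin h), S.card = 3 ∧ F = S.powerset := by
  classical
  obtain ⟨S, hS, hScard⟩ := Finset.exists_subset_card_eq hx3
  have hsub : S.powerset ⊆ F := by
    intro t ht
    rw [Finset.mem_powerset] at ht
    exact hlow x hx t (ht.trans hS)
  refine ⟨S, hScard, ?_⟩
  symm
  apply Finset.eq_of_subset_of_card_le hsub
  rw [Finset.card_powerset, hScard]
  omega

/-- A lower family of at most eight sets with at least five members of size `≤ 1` consists of
sets of size `≤ 2` (the power set of a `3`-set has only four such members). -/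
theorem card_le_two_of_five_small {h : ℕ} (F : Finset (Finset (Fin h)))
    (hlow : ∀ x ∈ F, ∀ t, t ⊆ x → t ∈ F) (hF : F.card ≤ 8)
    (hsmall : 5 ≤ (F.filter fun t => t.card ≤ 1).card) (x : Finset (Fin h)) (hx : x ∈ F) :
    x.card ≤ 2 := by
  classical
  by_contra hlt
  push Not at hlt
  obtain ⟨S, hS3, hFS⟩ := eq_powerset_of_three_le_card F hlow hF x hx (by omega)
  -- the members of size ≤ 1 of a power set of a 3-set: ∅ and three singletons
  have hsub : (F.filter fun t => t.card ≤ 1) ⊆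
      insert (∅ : Finset (Fin h)) (S.image fun a => ({a} : Finset (Fin h))) := by
    intro t ht
    rw [Finset.mem_filter, hFS, Finset.mem_powerset] at ht
    obtain ⟨htS, ht1⟩ := ht
    rcases Nat.lt_or_ge t.card 1 with h0 | h1
    · rw [Finset.card_eq_zero.mp (show t.card = 0 by omega)]
      exact Finset.mem_insert_self _ _
    · obtain ⟨a, rfl⟩ := Finset.card_eq_one.mp (show t.card = 1 by omega)
      exact Finset.mem_insert_of_mem (Finset.mem_image.mpr ⟨a, htS (Finset.mem_singleton_self a), rfl⟩)
  have hle := Finset.card_le_card hsub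
  have h4 : (insert (∅ : Finset (Fin h)) (S.image fun a => ({a} : Finset (Fin h)))).card ≤ 4 := by
    refine (Finset.card_insert_le _ _).trans ?_
    have := Finset.card_image_le (s := S) (f := fun a => ({a} : Finset (Fin h)))
    omega
  omega

/-- For an injective lower-set layout using all `h ≥ 4` coordinates, with at most eight members,
every member has at most two elements. -/
theorem face_card_le_two_of_full {h r : ℕ} (u : Fin r → Finset (Fin h))
    (hl : IsLowerSet (Set.range u)) (hfull : ∀ a : Fin h, ∃ i, a ∈ u i) (hr : 0 < r)
    (hr8 : r ≤ 8) (h4 : 4 ≤ h) (i : Fin r) : (u i).card ≤ 2 := by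
  classical
  obtain ⟨hsub, hcard⟩ := claw_subset_image u hl hfull hr
  have hlow : ∀ x ∈ Finset.univ.image u, ∀ t, t ⊆ x → t ∈ Finset.univ.image u := by
    intro x hx t ht
    obtain ⟨i, _, rfl⟩ := Finset.mem_image.mp hx
    obtain ⟨j, hj⟩ := hl ht ⟨i, rfl⟩
    exact Finset.mem_image.mpr ⟨j, Finset.mem_univ _, hj⟩
  have himg : (Finset.univ.image u).card ≤ 8 := Finset.card_image_le.trans (by simp [hr8])
  refine card_le_two_of_five_small _ hlow himg ?_ (u i)
    (Finset.mem_image.mpr ⟨i, Finset.mem_univ _, rfl⟩)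
  have hsub' : insert (∅ : Finset (Fin h))
      (Finset.univ.image fun a : Fin h => ({a} : Finset (Fin h))) ⊆
      (Finset.univ.image u).filter fun t => t.card ≤ 1 := by
    intro t ht
    refine Finset.mem_filter.mpr ⟨hsub ht, ?_⟩
    rw [Finset.mem_insert, Finset.mem_image] at ht
    rcases ht with rfl | ⟨a, _, rfl⟩ <;> simp
  have := Finset.card_le_card hsub'
  rw [hcard] at this
  omega

/-! ## 2. The graph case: a pair member exists -/

/-- Graph case of `exists_pair_of_no_degree_one`: if members have size `≤ 2` and no element has
degree one, every singleton member lies in a pair member and a pair member exists. -/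
theorem exists_pair_of_no_degree_one' {h : ℕ} (F : Finset (Finset (Fin h)))
    (hlow : ∀ x ∈ F, ∀ t, t ⊆ x → t ∈ F) (hle2 : ∀ x ∈ F, x.card ≤ 2) (hF2 : 2 ≤ F.card)
    (hdeg : ∀ c : Fin h, (F.filter fun x => c ∈ x).card ≠ 1) :
    (∀ c : Fin h, ({c} : Finset (Fin h)) ∈ F → ∃ y ∈ F, c ∈ y ∧ y.card = 2) ∧
      ∃ x ∈ F, x.card = 2 := by
  classical
  have hpairOf : ∀ c : Fin h, ({c} : Finset (Fin h)) ∈ F → ∃ y ∈ F, c ∈ y ∧ y.card = 2 := by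
    intro c hc
    by_contra hno
    push Not at hno
    apply hdeg c
    rw [Finset.card_eq_one]
    refine ⟨{c}, Finset.eq_singleton_iff_unique_mem.mpr ⟨Finset.mem_filter.mpr ⟨hc, by simp⟩,
      fun y hy => ?_⟩⟩
    rw [Finset.mem_filter] at hy
    have hy2 := hno y hy.1 hy.2
    have hy1 : y.card ≤ 1 := by have := hle2 y hy.1; omega
    exact Finset.eq_singleton_iff_unique_mem.mpr ⟨hy.2, fun e he =>
      Finset.card_le_one.mp hy1 e he c hy.2⟩
  refine ⟨hpairOf, ?_⟩
  obtain ⟨x, hxF, hxne⟩ : ∃ x ∈ F, x ≠ ∅ := by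
    by_contra hno
    push Not at hno
    have : F ⊆ {∅} := fun x hx => Finset.mem_singleton.mpr (hno x hx)
    have := Finset.card_le_card this
    rw [Finset.card_singleton] at this
    omega
  obtain ⟨c, hc⟩ := Finset.nonempty_iff_ne_empty.mpr hxne
  obtain ⟨y, hyF, _, hy2⟩ := hpairOf c (hlow x hxF _ (Finset.singleton_subset_iff.mpr hc))
  exact ⟨y, hyF, hy2⟩

end Summit.ValiantsHypothesis.ValiantsHypothesis.Theorems.BarrierLever.FiniteCheck
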